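import Mathlib.Analysis.SpecialFunctions.ImproperIntegrals
import Mathlib.Analysis.SpecialFunctions.Integrability.Basic
import Mathlib.NumberTheory.Harmonic.ZetaAsymp
import Literature.NumberTheory.LFunctions.BaezDuarteSequentialProofs
import Literature.NumberTheory.LFunctions.TrivialZerosSimple
import HarnessLib

/-!
# RH-EQUIVALENT column · Báez-Duarte's sequential criterion, SIMPLICITY CLAUSE `BaezDuarte2005_thm_1_1_simple` PROVED: `c_k ≪ k^{−3/4}` ⟹ every zero of `ζ` is simple — nothing here bears on the truth of RH

Literature service of the RH criterion columns (cell `pub/rh-columns`, seat `rh-columns-lit`;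
column (iv) Li / Báez-Duarte / Nyman–Beurling). The typed one-sided named fact
`BaezDuarte2005_thm_1_1_simple` (file `RieszTypeSeriesCriteria`, tranche `rh-lit-broughan-2`) reads

  `(c_k) = O(k^{−3/4})  →  ∀ s, ζ(s) = 0 → ζ'(s) ≠ 0`,

with Báez-Duarte's coefficients `c_k = Σ_{j≤k} (−1)^j (k choose j)/ζ(2j+2)` (`baezDuarteCoeff`);
it is the last sentence of [BaezDuarte2005, Thm. 1.1]: "Furthermore, if `c_k ≪ k^{−3/4}`, then the
zeros of `ζ(s)` are simple." This file PROVES it: `theorem BaezDuarte2005_thm_1_1_simple_holds`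
(D-0026 discharge; no definition, no new fact; standard axioms).

## The printed proof and the road taken here

Báez-Duarte [BaezDuarte2005, §3, end of the section (after (3.9)), pp. 3533–3534]: "Assume that
`c_k ≪ k^{−3/4}`. Take any fixed `s = 1/2 + iβ` on the critical line and `0 < h ≤ δ` … By (3.1)
[`1/ζ(s) = Σ_k c_k P_k(s/2)`, valid for `Re s > 1/2` under the hypothesis] … by Lemma 2.2
[`|P_k(s)| ≤ C k^{−Re s}` locally uniformly] there is a constant … [so that
`1/|ζ(s+h)| ≪ Σ_k k^{−3/4} k^{−1/4−h/2} ≪ 1/h`]. This shows that if `ζ(s) = 0`, then `s` can only be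
a simple zero." (The hypothesis implies RH by the main clause of Thm. 1.1, so every non-trivial zero
is `1/2 + iβ`.)

The MECHANISM is followed verbatim — at a critical zero `ρ`, `|ζ(ρ + 2h)| ≫ h` as `h ↓ 0`, which is
incompatible with `ζ'(ρ) = 0` — but the bound `1/|ζ| ≪ 1/h` to the right of the line is obtained,
as in the tree's proofs of the two halves of Thm. 1.1 (`BaezDuarteSequentialProofs`,
`BaezDuarteSequentialNecessityProofs`: "a shorter road … a deviation, recorded as such"), from the
Mellin transform of Riesz's function instead of the Pochhammer series (3.1): by the tree's
Poissonisation transfer `rieszFunction_isBigO_of_baezDuarteCoeff_isBigO` (with `a = 3/4`) the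
hypothesis gives `F(x) = O(x^{1/4})` (no `ε`), hence `|∫₀^∞ F(t) t^{z−1} dt| ≤ A/h` on the line
`Re z = −1/4 − h` (§2), while `(∫₀^∞ F(t) t^{z−1} dt)·ζ(−2z) = Γ(z+1)` persists on the punctured
strip `−1 < Re z < −1/4`, `z ≠ −1/2` (§3, the continuation argument of `RieszCriterionProofs` §4);
at `z = −ρ/2 − h` this reads `|Γ(1 − ρ/2 − h)| ≤ (A/h)|ζ(ρ + 2h)|`, and `Γ(1 − ρ/2) ≠ 0` (§4).
The trivial zeros, which the typed statement also covers ("the trivial zeros are simple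
unconditionally", docstring of the fact), are the tree's `deriv_riemannZeta_trivialZero_ne_zero`
(file `TrivialZerosSimple`: the functional equation `ζ(1−t) = 2(2π)^{−t} Γ(t) cos(πt/2) ζ(t)` at
`t = 2n+3`, where `cos(πt/2)` has a simple zero and the cofactor does not vanish).

* §1 `exists_bound_rieszFunction_of_isBigO` — `F = O(x^{1/4})` at `+∞` and continuity give one
  constant on `[1, ∞)`; `isBigO_rpow_add_of_isBigO_rpow` (`ε`-weakening).
* §2 `norm_mellin_rieszFunction_le` — `|M(z)| ≤ (4e + C)/h` for `Re z = −1/4 − h`, `0 < h ≤ 1/2`.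
* §3 `mellin_rieszFunction_mul_riemannZeta_eq_Gamma_of_isBigO` — the identity on the punctured strip.
* §4 `exists_mul_le_norm_riemannZeta_of_re_eq_half` — `c·h ≤ |ζ(ρ+2h)|` for small `h > 0`.
* §5 `deriv_ne_zero_of_mul_le_norm` — such a lower bound at a zero forces `f'(ρ) ≠ 0`.
* §6 `BaezDuarte2005_thm_1_1_simple_holds` (trivial zeros: the tree's
  `deriv_riemannZeta_trivialZero_ne_zero`).

RH-EQUIVALENT column bookkeeping: a ONE-SIDED printed implication about `ζ`, proved; it is not an
RH criterion by itself and nothing here bears on the truth of RH.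

## References

* [BaezDuarte2005] L. Báez-Duarte, *A sequential Riesz-like criterion for the Riemann hypothesis*,
  Int. J. Math. Math. Sci. 2005:21, 3527–3537, doi:10.1155/IJMMS.2005.3527, Thm. 1.1 (last
  sentence) and §3, pp. 3533–3534 [corpus: paper:doi-10-1155-ijmms-2005-3527, chunk 3 ll. 71–79];
  the arXiv version math/0307215 (2003) does not yet contain the simplicity clause.
* [Titchmarsh1986] E. C. Titchmarsh, *The Theory of the Riemann Zeta-Function*, 2nd ed., §14.32
  (Mellin transform of Riesz's function).
-/

noncomputable section

open MeasureTheory Set Filter Asymptotics Complex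

open scoped Real Topology

namespace Literature.NumberTheory.LFunctions

/-! ## §1 From `O`-bounds to explicit constants -/

/-- If `F(x) = O(x^{1/4})` as `x → +∞` then, `F` being continuous, one constant serves on all of
`[1, ∞)`: `|F(t)| ≤ C t^{1/4}` for `t ≥ 1`. [cite: BaezDuarte2005, §3 (pp. 3533–3534), the hypothesis c_k ≪ k^{−3/4} transported to Riesz's F] -/
theorem exists_bound_rieszFunction_of_isBigO
    (h : rieszFunction =O[atTop] fun x : ℝ ↦ x ^ (1 / 4 : ℝ)) :
    ∃ C : ℝ, 0 < C ∧ ∀ t : ℝ, 1 ≤ t → |rieszFunction t| ≤ C * t ^ (1 / 4 : ℝ) := by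
  obtain ⟨C₀, hC₀pos, hC₀⟩ := h.exists_pos
  rw [isBigOWith_iff, eventually_atTop] at hC₀
  obtain ⟨X, hX⟩ := hC₀
  obtain ⟨B, hB⟩ := (isCompact_Icc (a := (1 : ℝ)) (b := max X 1)).exists_bound_of_continuousOn
    continuous_rieszFunction.continuousOn
  refine ⟨max C₀ B + 1, by positivity, fun t ht ↦ ?_⟩
  have ht0 : 0 < t := by linarith
  have hpow1 : 1 ≤ t ^ (1 / 4 : ℝ) := Real.one_le_rpow ht (by norm_num)
  have hpow0 : 0 < t ^ (1 / 4 : ℝ) := by positivity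
  rcases le_or_gt X t with hXt | hXt
  · have := hX t hXt
    rw [Real.norm_eq_abs, Real.norm_of_nonneg hpow0.le] at this
    calc |rieszFunction t| ≤ C₀ * t ^ (1 / 4 : ℝ) := this
      _ ≤ (max C₀ B + 1) * t ^ (1 / 4 : ℝ) := by
          gcongr
          linarith [le_max_left C₀ B]
  · have htI : t ∈ Icc 1 (max X 1) := ⟨ht, le_trans hXt.le (le_max_left _ _)⟩
    have := hB t htI
    rw [Real.norm_eq_abs] at this
    calc |rieszFunction t| ≤ B := this
      _ ≤ (max C₀ B + 1) * 1 := by linarith [le_max_right C₀ B]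
      _ ≤ (max C₀ B + 1) * t ^ (1 / 4 : ℝ) := by gcongr

/-- `ε`-weakening of a power bound at `+∞` on `ℝ`: `O(x^a)` implies `O(x^{a+ε})` for `ε ≥ 0`.
[cite: Titchmarsh1986, §14.32 (the O(x^{1/4+ε}) form of Riesz's condition)] -/
theorem isBigO_rpow_add_of_isBigO_rpow {f : ℝ → ℝ} {a ε : ℝ} (hε : 0 ≤ ε)
    (h : f =O[atTop] fun x : ℝ ↦ x ^ a) : f =O[atTop] fun x : ℝ ↦ x ^ (a + ε) := by
  refine h.trans (IsBigO.of_bound 1 ?_)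
  filter_upwards [eventually_ge_atTop (1 : ℝ)] with x hx
  rw [one_mul, Real.norm_of_nonneg (by positivity), Real.norm_of_nonneg (by positivity)]
  exact Real.rpow_le_rpow_of_exponent_le hx (by linarith)

/-- The same on `ℕ` (for Báez-Duarte's coefficients): `O(k^a)` implies `O(k^{a+ε})` for `ε ≥ 0`.
[cite: BaezDuarte2005, Thm. 1.1 (c_k ≪ k^{−3/4} implies c_k ≪ k^{−3/4+ε})] -/
theorem isBigO_natCast_rpow_add_of_isBigO {c : ℕ → ℝ} {a ε : ℝ} (hε : 0 ≤ ε)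
    (h : c =O[atTop] fun k : ℕ ↦ (k : ℝ) ^ a) : c =O[atTop] fun k : ℕ ↦ (k : ℝ) ^ (a + ε) := by
  refine h.trans (IsBigO.of_bound 1 ?_)
  filter_upwards [eventually_ge_atTop 1] with k hk
  have hk' : (1 : ℝ) ≤ k := by exact_mod_cast hk
  rw [one_mul, Real.norm_of_nonneg (by positivity), Real.norm_of_nonneg (by positivity)]
  exact Real.rpow_le_rpow_of_exponent_le hk' (by linarith)

/-! ## §2 The Mellin transform of Riesz's function is `O(1/h)` on the line `Re z = −1/4 − h` -/

/-- **Growth `O(x^{1/4})` ⟹ `|∫₀^∞ F(t) t^{z−1} dt| ≤ (4e + C)/h` on `Re z = −1/4 − h`**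
(`0 < h ≤ 1/2`): on `(0,1]` the integrand is at most `e·t^{−1/4−h} ≤ e·t^{−3/4}` (`|F(t)| ≤ t e^t`),
on `[1,∞)` at most `C t^{−1−h}`, whose integral is `C/h`. This is the tree's form of Báez-Duarte's
"`1/|ζ(s+h)| ≤` const`·Σ_k k^{−1−h/2} ≪ 1/h`". [cite: BaezDuarte2005, §3 pp. 3533–3534 (the bound ≪ 1/h to the right of the critical line); Titchmarsh1986, §14.32] -/
theorem norm_mellin_rieszFunction_le {C : ℝ} (hC : 0 < C)
    (hF : ∀ t : ℝ, 1 ≤ t → |rieszFunction t| ≤ C * t ^ (1 / 4 : ℝ))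
    (hO : rieszFunction =O[atTop] fun x : ℝ ↦ x ^ (1 / 4 : ℝ))
    {z : ℂ} {h : ℝ} (hh : 0 < h) (hh1 : h ≤ 1 / 2) (hz : z.re = -(1 / 4) - h) :
    ‖mellin (fun t : ℝ ↦ (rieszFunction t : ℂ)) z‖ ≤ (4 * Real.exp 1 + C) / h := by
  set f : ℝ → ℂ := fun t ↦ (t : ℂ) ^ (z - 1) • ((rieszFunction t : ℝ) : ℂ) with hf
  -- absolute convergence of the Mellin integral on `-1 < Re z < -1/4`
  have hconv : IntegrableOn f (Ioi 0) := by
    have : MellinConvergent (fun t : ℝ ↦ (rieszFunction t : ℂ)) z := by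
      refine mellinConvergent_of_isBigO_rpow (a := -(1 / 4)) (b := -1) ?_ ?_ ?_ ?_ ?_
      · exact (continuous_ofReal.comp continuous_rieszFunction).locallyIntegrable.locallyIntegrableOn _
      · refine (Complex.isBigO_ofReal_left.2 hO).congr_right fun x ↦ ?_
        rw [neg_neg]
      · rw [hz]; linarith
      · refine IsBigO.of_bound (Real.exp 1) ?_
        filter_upwards [Ioo_mem_nhdsGT (zero_lt_one' ℝ)] with x hx
        rw [Complex.norm_real, neg_neg, Real.rpow_one, Real.norm_of_nonneg hx.1.le]
        calc ‖rieszFunction x‖ ≤ |x| * Real.exp |x| := norm_rieszFunction_le x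
          _ ≤ x * Real.exp 1 := by
              rw [abs_of_pos hx.1]
              exact mul_le_mul_of_nonneg_left (Real.exp_le_exp.2 hx.2.le) hx.1.le
          _ = Real.exp 1 * x := mul_comm _ _
      · rw [hz]; linarith
    exact this
  -- the norm of the integrand
  have hnorm : ∀ t : ℝ, 0 < t → ‖f t‖ = t ^ (z.re - 1) * |rieszFunction t| := by
    intro t ht
    rw [hf]
    simp only [smul_eq_mul, norm_mul, Complex.norm_real, Real.norm_eq_abs]
    rw [Complex.norm_cpow_eq_rpow_re_of_pos ht, sub_re, one_re]
  -- piece `(0,1]`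
  have hI1 : IntegrableOn (fun t : ℝ ↦ Real.exp 1 * t ^ (-(3 / 4) : ℝ)) (Ioc 0 1) :=
    ((intervalIntegral.intervalIntegrable_rpow' (a := 0) (b := 1)
      (by norm_num : (-1 : ℝ) < -(3 / 4))).1).const_mul _
  have hb1 : ∀ t ∈ Ioc (0 : ℝ) 1, ‖f t‖ ≤ Real.exp 1 * t ^ (-(3 / 4) : ℝ) := by
    intro t ht
    rw [hnorm t ht.1, hz]
    have hFt : |rieszFunction t| ≤ t * Real.exp 1 := by
      have := norm_rieszFunction_le t
      rw [Real.norm_eq_abs, abs_of_pos ht.1] at this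
      exact this.trans (mul_le_mul_of_nonneg_left (Real.exp_le_exp.2 ht.2) ht.1.le)
    have hexp : t ^ (-(1 / 4) - h - 1 : ℝ) * t = t ^ (-(1 / 4) - h : ℝ) := by
      rw [show (-(1 / 4) - h - 1 : ℝ) = (-(1 / 4) - h) - 1 by ring, Real.rpow_sub_one ht.1.ne',
        div_mul_cancel₀ _ ht.1.ne']
    have hmono : t ^ (-(1 / 4) - h : ℝ) ≤ t ^ (-(3 / 4) : ℝ) :=
      Real.rpow_le_rpow_of_exponent_ge ht.1 ht.2 (by linarith)
    calc t ^ (-(1 / 4) - h - 1 : ℝ) * |rieszFunction t|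
        ≤ t ^ (-(1 / 4) - h - 1 : ℝ) * (t * Real.exp 1) :=
          mul_le_mul_of_nonneg_left hFt (Real.rpow_nonneg ht.1.le _)
      _ = t ^ (-(1 / 4) - h : ℝ) * Real.exp 1 := by rw [← mul_assoc, hexp]
      _ ≤ t ^ (-(3 / 4) : ℝ) * Real.exp 1 := by gcongr
      _ = Real.exp 1 * t ^ (-(3 / 4) : ℝ) := mul_comm _ _
  have hv1 : ∫ t in Ioc (0 : ℝ) 1, Real.exp 1 * t ^ (-(3 / 4) : ℝ) = 4 * Real.exp 1 := by
    rw [integral_const_mul, ← intervalIntegral.integral_of_le zero_le_one,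
      integral_rpow (Or.inl (by norm_num : (-1 : ℝ) < -(3 / 4)))]
    norm_num
    ring
  -- piece `[1,∞)`
  have hI2 : IntegrableOn (fun t : ℝ ↦ C * t ^ (-1 - h : ℝ)) (Ioi 1) :=
    (integrableOn_Ioi_rpow_of_lt (by linarith) zero_lt_one).const_mul _
  have hb2 : ∀ t ∈ Ioi (1 : ℝ), ‖f t‖ ≤ C * t ^ (-1 - h : ℝ) := by
    intro t ht
    have ht0 : 0 < t := lt_trans zero_lt_one ht
    rw [hnorm t ht0, hz]
    have hexp : t ^ (-(1 / 4) - h - 1 : ℝ) * t ^ (1 / 4 : ℝ) = t ^ (-1 - h : ℝ) := by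
      rw [← Real.rpow_add ht0]; congr 1; ring
    calc t ^ (-(1 / 4) - h - 1 : ℝ) * |rieszFunction t|
        ≤ t ^ (-(1 / 4) - h - 1 : ℝ) * (C * t ^ (1 / 4 : ℝ)) := by gcongr; exact hF t ht.le
      _ = C * t ^ (-1 - h : ℝ) := by rw [← hexp]; ring
  have hv2 : ∫ t in Ioi (1 : ℝ), C * t ^ (-1 - h : ℝ) = C / h := by
    rw [integral_const_mul, integral_Ioi_rpow_of_lt (by linarith) zero_lt_one, Real.one_rpow]
    have : (-1 - h + 1 : ℝ) = -h := by ring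
    rw [this]
    field_simp
  -- split and bound
  have hsplit : mellin (fun t : ℝ ↦ (rieszFunction t : ℂ)) z =
      (∫ t in Ioc (0 : ℝ) 1, f t) + ∫ t in Ioi (1 : ℝ), f t := by
    rw [mellin, ← setIntegral_union Ioc_disjoint_Ioi_same measurableSet_Ioi
      (hconv.mono_set Ioc_subset_Ioi_self) (hconv.mono_set (Ioi_subset_Ioi zero_le_one)),
      Ioc_union_Ioi_eq_Ioi zero_le_one]
  have hn1 : ‖∫ t in Ioc (0 : ℝ) 1, f t‖ ≤ 4 * Real.exp 1 := by
    rw [← hv1]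
    exact norm_integral_le_of_norm_le hI1 (ae_restrict_of_forall_mem measurableSet_Ioc hb1)
  have hn2 : ‖∫ t in Ioi (1 : ℝ), f t‖ ≤ C / h := by
    rw [← hv2]
    exact norm_integral_le_of_norm_le hI2 (ae_restrict_of_forall_mem measurableSet_Ioi hb2)
  have h4e : 4 * Real.exp 1 ≤ 4 * Real.exp 1 / h := by
    rw [le_div_iff₀ hh]
    have : 0 < Real.exp 1 := Real.exp_pos 1
    nlinarith
  calc ‖mellin (fun t : ℝ ↦ (rieszFunction t : ℂ)) z‖
      = ‖(∫ t in Ioc (0 : ℝ) 1, f t) + ∫ t in Ioi (1 : ℝ), f t‖ := by rw [hsplit]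
    _ ≤ ‖∫ t in Ioc (0 : ℝ) 1, f t‖ + ‖∫ t in Ioi (1 : ℝ), f t‖ := norm_add_le _ _
    _ ≤ 4 * Real.exp 1 / h + C / h := add_le_add (hn1.trans h4e) hn2
    _ = (4 * Real.exp 1 + C) / h := by ring

/-! ## §3 The identity `(∫₀^∞ F(t) t^{z−1} dt)·ζ(−2z) = Γ(z+1)` on the punctured strip `−1 < Re z < −1/4 − ε`, `z ≠ −1/2` -/

/-- The punctured strip `{−1 < Re z < c} ∖ {−1/2}` (`c > −1/2`) is preconnected — the domain of the
analytic continuation; verbatim the (private) lemma of `RieszCriterionProofs` §4, restated here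
because it is not exported there. [cite: Titchmarsh1986, §14.32 (analytic continuation of Γ(1−s)/ζ(2s))] -/
private theorem isPreconnected_puncturedStrip {c : ℝ} (hc : -1 / 2 < c) :
    IsPreconnected {z : ℂ | (-1 < z.re ∧ z.re < c) ∧ z ≠ -1 / 2} := by
  have hA : IsPreconnected {z : ℂ | -1 < z.re ∧ z.re < -1 / 2} :=
    ((convex_halfSpace_re_gt (-1)).inter (convex_halfSpace_re_lt (-1 / 2))).isPreconnected
  have hB : IsPreconnected {z : ℂ | -1 / 2 < z.re ∧ z.re < c} :=
    ((convex_halfSpace_re_gt (-1 / 2)).inter (convex_halfSpace_re_lt c)).isPreconnected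
  have hCp : IsPreconnected {z : ℂ | (-1 < z.re ∧ z.re < c) ∧ 0 < z.im} :=
    (((convex_halfSpace_re_gt (-1)).inter (convex_halfSpace_re_lt c)).inter
      (convex_halfSpace_im_gt 0)).isPreconnected
  have hCm : IsPreconnected {z : ℂ | (-1 < z.re ∧ z.re < c) ∧ z.im < 0} :=
    (((convex_halfSpace_re_gt (-1)).inter (convex_halfSpace_re_lt c)).inter
      (convex_halfSpace_im_lt 0)).isPreconnected
  have h1 : IsPreconnected ({z : ℂ | -1 < z.re ∧ z.re < -1 / 2} ∪
      {z : ℂ | (-1 < z.re ∧ z.re < c) ∧ 0 < z.im}) := by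
    refine IsPreconnected.union (⟨-3 / 4, 1⟩ : ℂ) ?_ ?_ hA hCp
    · exact ⟨show (-1 : ℝ) < -3 / 4 by norm_num, show (-3 / 4 : ℝ) < -1 / 2 by norm_num⟩
    · exact ⟨⟨show (-1 : ℝ) < -3 / 4 by norm_num, show (-3 / 4 : ℝ) < c by linarith⟩,
        show (0 : ℝ) < 1 by norm_num⟩
  have h2 : IsPreconnected (({z : ℂ | -1 < z.re ∧ z.re < -1 / 2} ∪
      {z : ℂ | (-1 < z.re ∧ z.re < c) ∧ 0 < z.im}) ∪
      {z : ℂ | (-1 < z.re ∧ z.re < c) ∧ z.im < 0}) := by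
    refine IsPreconnected.union (⟨-3 / 4, -1⟩ : ℂ) ?_ ?_ h1 hCm
    · exact Or.inl ⟨show (-1 : ℝ) < -3 / 4 by norm_num, show (-3 / 4 : ℝ) < -1 / 2 by norm_num⟩
    · exact ⟨⟨show (-1 : ℝ) < -3 / 4 by norm_num, show (-3 / 4 : ℝ) < c by linarith⟩,
        show (-1 : ℝ) < 0 by norm_num⟩
  have h3 : IsPreconnected ((({z : ℂ | -1 < z.re ∧ z.re < -1 / 2} ∪
      {z : ℂ | (-1 < z.re ∧ z.re < c) ∧ 0 < z.im}) ∪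
      {z : ℂ | (-1 < z.re ∧ z.re < c) ∧ z.im < 0}) ∪
      {z : ℂ | -1 / 2 < z.re ∧ z.re < c}) := by
    refine IsPreconnected.union (⟨(-1 / 2 + c) / 2, 1⟩ : ℂ) ?_ ?_ h2 hB
    · exact Or.inl (Or.inr ⟨⟨show (-1 : ℝ) < (-1 / 2 + c) / 2 by linarith,
        show ((-1 / 2 + c) / 2 : ℝ) < c by linarith⟩, show (0 : ℝ) < 1 by norm_num⟩)
    · exact ⟨show (-1 / 2 : ℝ) < (-1 / 2 + c) / 2 by linarith,
        show ((-1 / 2 + c) / 2 : ℝ) < c by linarith⟩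
  convert h3 using 1
  ext z
  simp only [mem_union, mem_setOf_eq]
  have hre : (-1 / 2 : ℂ).re = -1 / 2 := by norm_num
  have him : (-1 / 2 : ℂ).im = 0 := by norm_num
  constructor
  · rintro ⟨⟨h1, h2⟩, hne⟩
    rcases lt_trichotomy z.im 0 with hlt | heq | hgt
    · exact Or.inl (Or.inr ⟨⟨h1, h2⟩, hlt⟩)
    · have hzre : z.re ≠ -1 / 2 := fun h ↦ hne (Complex.ext (by rw [h, hre]) (by rw [heq, him]))
      rcases lt_or_gt_of_ne hzre with hl | hg
      · exact Or.inl (Or.inl (Or.inl ⟨h1, hl⟩))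
      · exact Or.inr ⟨hg, h2⟩
    · exact Or.inl (Or.inl (Or.inr ⟨⟨h1, h2⟩, hgt⟩))
  · rintro (((⟨h1, h2⟩ | ⟨⟨h1, h2⟩, h3⟩) | ⟨⟨h1, h2⟩, h3⟩) | ⟨h1, h2⟩)
    · exact ⟨⟨h1, by linarith⟩, fun h ↦ by rw [h, hre] at h2; linarith⟩
    · exact ⟨⟨h1, h2⟩, fun h ↦ by rw [h, him] at h3; linarith⟩
    · exact ⟨⟨h1, h2⟩, fun h ↦ by rw [h, him] at h3; linarith⟩
    · exact ⟨⟨by linarith, h2⟩, fun h ↦ by rw [h, hre] at h1; linarith⟩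

/-- **Analytic continuation of `M(z)·ζ(−2z) = Γ(z+1)`** (`M(z) = ∫₀^∞ F(t) t^{z−1} dt`): if
`F(x) = O(x^{1/4+ε})` at `+∞` with `ε < 1/4`, then the identity — which holds on
`−1 < Re z < −1/2` by termwise integration (`mellin_rieszFunction_mul_riemannZeta`) — holds at
every point of the punctured strip `−1 < Re z < −1/4 − ε`, `z ≠ −1/2` (where `ζ(−2z)` has its
pole). This is the continuation step of `riemannHypothesis_of_rieszFunction_isBigO`
(`RieszCriterionProofs` §4), isolated as a reusable statement. [cite: Titchmarsh1986, §14.32 ("if (14.32.2) holds … Γ(1−s)/ζ(2s) is regular for σ > 1/4+ε")] -/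
theorem mellin_rieszFunction_mul_riemannZeta_eq_Gamma_of_isBigO {ε : ℝ}
    (hε' : ε < 1 / 4) (hO : rieszFunction =O[atTop] fun x : ℝ ↦ x ^ (1 / 4 + ε)) {z : ℂ}
    (hz1 : -1 < z.re) (hz2 : z.re < -(1 / 4) - ε) (hz3 : z ≠ -1 / 2) :
    mellin (fun t : ℝ ↦ (rieszFunction t : ℂ)) z * riemannZeta (-2 * z) = Gamma (z + 1) := by
  set c : ℝ := -(1 / 4) - ε with hc
  have hc1 : -1 / 2 < c := by rw [hc]; linarith
  have hre : (-1 / 2 : ℂ).re = -1 / 2 := by norm_num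
  have hUo : IsOpen {z : ℂ | (-1 < z.re ∧ z.re < c) ∧ z ≠ -1 / 2} :=
    ((isOpen_lt continuous_const continuous_re).inter
      (isOpen_lt continuous_re continuous_const)).inter isOpen_ne
  have hΦ : AnalyticOnNhd ℂ
      (fun z ↦ mellin (fun t : ℝ ↦ (rieszFunction t : ℂ)) z * riemannZeta (-2 * z))
      {z : ℂ | (-1 < z.re ∧ z.re < c) ∧ z ≠ -1 / 2} := by
    refine DifferentiableOn.analyticOnNhd
      (fun z hz ↦ DifferentiableAt.differentiableWithinAt ?_) hUo
    refine (differentiableAt_mellin_rieszFunction hO hz.1.1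
      (by rw [hc] at hz; exact hz.1.2)).mul ?_
    refine (differentiableAt_riemannZeta ?_).comp z
      ((differentiableAt_const _).mul differentiableAt_id)
    intro h'
    exact hz.2 (by linear_combination (-1 / 2 : ℂ) * h')
  have hΨ : AnalyticOnNhd ℂ (fun z ↦ Gamma (z + 1))
      {z : ℂ | (-1 < z.re ∧ z.re < c) ∧ z ≠ -1 / 2} := by
    refine DifferentiableOn.analyticOnNhd
      (fun z hz ↦ DifferentiableAt.differentiableWithinAt ?_) hUo
    refine (differentiableAt_Gamma _ fun m hm ↦ ?_).comp z
      (differentiableAt_id.add (differentiableAt_const _))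
    have := congrArg re hm
    simp only [add_re, one_re, neg_re, natCast_re] at this
    linarith [hz.1.1, (Nat.cast_nonneg m : (0 : ℝ) ≤ m)]
  have hz₁ : (⟨-3 / 4, 0⟩ : ℂ) ∈ {z : ℂ | (-1 < z.re ∧ z.re < c) ∧ z ≠ -1 / 2} :=
    ⟨⟨show (-1 : ℝ) < -3 / 4 by norm_num, show (-3 / 4 : ℝ) < c by linarith⟩,
      fun h0 ↦ by have := congrArg re h0; rw [hre] at this; norm_num at this⟩
  have heq : (fun z ↦ mellin (fun t : ℝ ↦ (rieszFunction t : ℂ)) z * riemannZeta (-2 * z))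
      =ᶠ[𝓝 (⟨-3 / 4, 0⟩ : ℂ)] fun z ↦ Gamma (z + 1) := by
    have hV : {z : ℂ | -1 < z.re ∧ z.re < -1 / 2} ∈ 𝓝 (⟨-3 / 4, 0⟩ : ℂ) :=
      ((isOpen_lt continuous_const continuous_re).inter
        (isOpen_lt continuous_re continuous_const)).mem_nhds
        ⟨show (-1 : ℝ) < -3 / 4 by norm_num, show (-3 / 4 : ℝ) < -1 / 2 by norm_num⟩
    exact eventuallyEq_of_mem hV fun z hz ↦ mellin_rieszFunction_mul_riemannZeta hz.1 hz.2
  have hEq := hΦ.eqOn_of_preconnected_of_eventuallyEq hΨ (isPreconnected_puncturedStrip hc1)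
    hz₁ heq
  have hzU : z ∈ {z : ℂ | (-1 < z.re ∧ z.re < c) ∧ z ≠ -1 / 2} := ⟨⟨hz1, hz2⟩, hz3⟩
  exact hEq hzU

/-! ## §4 At a point of the critical line: `c·h ≤ |ζ(ρ + 2h)|` for small `h > 0` -/

/-- **The key estimate** (Báez-Duarte: "`1/|ζ(s+h)|` is `≪ 1/h` for `s = 1/2 + iβ`"): if
`c_k`'s transfer gives `F(x) = O(x^{1/4})`, then for every `ρ` with `Re ρ = 1/2` there are `c > 0`
and `h₀ > 0` with `c·h ≤ |ζ(ρ + 2h)|` for `0 < h < h₀`. From §2–§3 at `z = −ρ/2 − h`: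
`|Γ(1 − ρ/2 − h)| = |M(z)|·|ζ(ρ+2h)| ≤ (A/h)|ζ(ρ+2h)|`, and `Γ(1 − ρ/2 − h) → Γ(1 − ρ/2) ≠ 0`.
[cite: BaezDuarte2005, §3 pp. 3533–3534 (eqs. after (3.9): 1/|ζ(s+h)| ≪ 1/h)] -/
theorem exists_mul_le_norm_riemannZeta_of_re_eq_half
    (hO : rieszFunction =O[atTop] fun x : ℝ ↦ x ^ (1 / 4 : ℝ)) {ρ : ℂ} (hρ : ρ.re = 1 / 2) :
    ∃ c h₀ : ℝ, 0 < c ∧ 0 < h₀ ∧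
      ∀ h : ℝ, 0 < h → h < h₀ → c * h ≤ ‖riemannZeta (ρ + 2 * h)‖ := by
  obtain ⟨C, hC, hF⟩ := exists_bound_rieszFunction_of_isBigO hO
  set A : ℝ := 4 * Real.exp 1 + C with hA
  have hApos : 0 < A := by rw [hA]; positivity
  -- `Γ` is continuous and non-zero at `w₀ = 1 - ρ/2`
  set w₀ : ℂ := 1 - ρ / 2 with hw₀
  have hw₀re : w₀.re = 3 / 4 := by
    rw [hw₀, sub_re, one_re, div_ofNat_re, hρ]; norm_num
  have hΓ0 : Gamma w₀ ≠ 0 := Gamma_ne_zero_of_re_pos (by rw [hw₀re]; norm_num)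
  have hΓcont : ContinuousAt Gamma w₀ := by
    refine (differentiableAt_Gamma w₀ fun m hm ↦ ?_).continuousAt
    have := congrArg re hm
    rw [hw₀re, neg_re, natCast_re] at this
    linarith [(Nat.cast_nonneg m : (0 : ℝ) ≤ m)]
  set g : ℝ := ‖Gamma w₀‖ with hg
  have hgpos : 0 < g := norm_pos_iff.2 hΓ0
  obtain ⟨δ, hδpos, hδ⟩ := Metric.continuousAt_iff.1 hΓcont (g / 2) (by positivity)
  refine ⟨g / (2 * A), min (1 / 4) δ, by positivity, lt_min (by norm_num) hδpos,
    fun h hh hhlt ↦ ?_⟩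
  have hh4 : h < 1 / 4 := lt_of_lt_of_le hhlt (min_le_left _ _)
  have hhδ : h < δ := lt_of_lt_of_le hhlt (min_le_right _ _)
  -- the point `z = -ρ/2 - h`
  set z : ℂ := -ρ / 2 - h with hz
  have hzre : z.re = -(1 / 4) - h := by
    rw [hz, sub_re, div_ofNat_re, neg_re, hρ, ofReal_re]; norm_num
  have hident := mellin_rieszFunction_mul_riemannZeta_eq_Gamma_of_isBigO (ε := h / 2)
    (by linarith) (isBigO_rpow_add_of_isBigO_rpow (by positivity) hO)
    (z := z) (by rw [hzre]; linarith) (by rw [hzre]; linarith) (by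
      intro h0
      have := congrArg re h0
      rw [hzre] at this
      norm_num at this
      linarith)
  have hzρ : -2 * z = ρ + 2 * h := by rw [hz]; ring
  have hz1 : z + 1 = w₀ - h := by rw [hz, hw₀]; ring
  rw [hzρ, hz1] at hident
  -- `‖Γ(w₀ - h)‖ ≥ g/2`
  have hΓlow : g / 2 ≤ ‖Gamma (w₀ - h)‖ := by
    have hd : dist (w₀ - ↑h) w₀ < δ := by
      rw [dist_eq_norm, sub_sub_cancel_left, norm_neg, Complex.norm_real, Real.norm_eq_abs,
        abs_of_pos hh]
      exact hhδ
    have := hδ hd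
    rw [dist_eq_norm] at this
    have htri : ‖Gamma w₀‖ ≤ ‖Gamma (w₀ - h)‖ + ‖Gamma (w₀ - h) - Gamma w₀‖ := by
      calc ‖Gamma w₀‖ = ‖Gamma (w₀ - h) - (Gamma (w₀ - h) - Gamma w₀)‖ := by ring_nf
        _ ≤ ‖Gamma (w₀ - h)‖ + ‖Gamma (w₀ - h) - Gamma w₀‖ := norm_sub_le _ _
    rw [hg]
    linarith
  -- the Mellin bound
  have hM : ‖mellin (fun t : ℝ ↦ (rieszFunction t : ℂ)) z‖ ≤ A / h :=
    norm_mellin_rieszFunction_le hC hF hO hh (by linarith) hzre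
  -- combine
  have hprod : g / 2 ≤ A / h * ‖riemannZeta (ρ + 2 * h)‖ := by
    calc g / 2 ≤ ‖Gamma (w₀ - h)‖ := hΓlow
      _ = ‖mellin (fun t : ℝ ↦ (rieszFunction t : ℂ)) z * riemannZeta (ρ + 2 * h)‖ := by
          rw [hident]
      _ = ‖mellin (fun t : ℝ ↦ (rieszFunction t : ℂ)) z‖ * ‖riemannZeta (ρ + 2 * h)‖ :=
          norm_mul _ _
      _ ≤ A / h * ‖riemannZeta (ρ + 2 * h)‖ := by gcongr
  have hAh : 0 < A / h := by positivity
  calc g / (2 * A) * h = (g / 2) / (A / h) := by field_simp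
    _ ≤ (A / h * ‖riemannZeta (ρ + 2 * h)‖) / (A / h) := by gcongr
    _ = ‖riemannZeta (ρ + 2 * h)‖ := by field_simp

/-! ## §5 A linear lower bound at a zero forces a non-vanishing derivative -/

/-- If `f` is differentiable at `ρ`, `f(ρ) = 0`, and `c·h ≤ |f(ρ + 2h)|` for all small `h > 0` with
some `c > 0`, then `f'(ρ) ≠ 0` (were `f'(ρ) = 0`, `f(ρ + w) = o(w)`). This is the step "this shows
that if `ζ(s) = 0`, then `s` can only be a simple zero". [cite: BaezDuarte2005, §3 p. 3534 (last sentence of the proof)] -/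
theorem deriv_ne_zero_of_mul_le_norm {f : ℂ → ℂ} {ρ : ℂ} (hf : DifferentiableAt ℂ f ρ)
    (h0 : f ρ = 0) {c h₀ : ℝ} (hc : 0 < c) (hh₀ : 0 < h₀)
    (hlow : ∀ h : ℝ, 0 < h → h < h₀ → c * h ≤ ‖f (ρ + 2 * h)‖) : deriv f ρ ≠ 0 := by
  intro hd
  have hder : HasDerivAt f 0 ρ := hd ▸ hf.hasDerivAt
  have hsmall := (hasDerivAt_iff_isLittleO.1 hder).def (c := c / 4) (by positivity)
  rw [Metric.eventually_nhds_iff] at hsmall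
  obtain ⟨δ, hδ, hball⟩ := hsmall
  set h : ℝ := min (h₀ / 2) (δ / 4) with hh
  have hhpos : 0 < h := by rw [hh]; positivity
  have hh₀' : h < h₀ := lt_of_le_of_lt (min_le_left _ _) (by linarith)
  have hhδ : 2 * h < δ := by
    have := min_le_right (h₀ / 2) (δ / 4)
    rw [← hh] at this
    linarith
  have hnorm2h : ‖((ρ + 2 * h) - ρ : ℂ)‖ = 2 * h := by
    rw [add_sub_cancel_left, show (2 * (h : ℂ)) = ((2 * h : ℝ) : ℂ) by push_cast; ring,
      Complex.norm_real, Real.norm_eq_abs, abs_of_pos (by positivity)]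
  have hdist : dist (ρ + 2 * h) ρ < δ := by rw [dist_eq_norm, hnorm2h]; exact hhδ
  have hup := hball hdist
  rw [h0, sub_zero, smul_zero, sub_zero, hnorm2h] at hup
  have hlo := hlow h hhpos hh₀'
  nlinarith

/-! ## §6 The simplicity clause of Báez-Duarte's Theorem 1.1 -/

/-- **Báez-Duarte 2005, Theorem 1.1, simplicity clause (PROVED):** if `c_k = O(k^{−3/4})`, then
every zero of `ζ` is simple. The hypothesis gives RH (`riemannHypothesis_of_baezDuarteCoeff_isBigO`,
after `ε`-weakening) and `F(x) = O(x^{1/4})` for Riesz's function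
(`rieszFunction_isBigO_of_baezDuarteCoeff_isBigO`, `a = 3/4`); at a non-trivial zero `ρ = 1/2 + iβ`,
§4 gives `c·h ≤ |ζ(ρ+2h)|`, whence `ζ'(ρ) ≠ 0` (§5); `s = 1` is not a zero
(`riemannZeta_one_ne_zero`) and the trivial zeros are simple (tree,
`deriv_riemannZeta_trivialZero_ne_zero`).
[cite: BaezDuarte2005, Thm. 1.1 (last sentence: "if c_k ≪ k^{−3/4}, then the zeros of ζ(s) are simple"), proof §3 pp. 3533–3534] -/
theorem baezDuarte_simple_zeros_of_isBigO
    (hO : (fun k : ℕ ↦ baezDuarteCoeff k) =O[atTop] fun k : ℕ ↦ (k : ℝ) ^ (-(3 / 4 : ℝ)))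
    {s : ℂ} (hs : riemannZeta s = 0) : deriv riemannZeta s ≠ 0 := by
  -- RH from the `ε`-weakened hypothesis
  have hRH : RiemannHypothesis :=
    riemannHypothesis_of_baezDuarteCoeff_isBigO fun ε hε ↦
      isBigO_natCast_rpow_add_of_isBigO hε.le hO
  -- `F = O(x^{1/4})`
  have hF : rieszFunction =O[atTop] fun x : ℝ ↦ x ^ (1 / 4 : ℝ) :=
    (rieszFunction_isBigO_of_baezDuarteCoeff_isBigO (a := 3 / 4) (by norm_num) (by norm_num)
      hO).congr_right fun x ↦ by norm_num
  by_cases htriv : ∃ n : ℕ, s = -2 * ((n : ℂ) + 1)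
  · obtain ⟨n, rfl⟩ := htriv
    exact deriv_riemannZeta_trivialZero_ne_zero n
  have hs1 : s ≠ 1 := by
    rintro rfl
    exact riemannZeta_one_ne_zero hs
  have hre : s.re = 1 / 2 := hRH s hs htriv hs1
  obtain ⟨c, h₀, hc, hh₀, hlow⟩ := exists_mul_le_norm_riemannZeta_of_re_eq_half hF hre
  exact deriv_ne_zero_of_mul_le_norm (differentiableAt_riemannZeta hs1) hs hc hh₀ hlow

/-- **DISCHARGE of the named fact** `BaezDuarte2005_thm_1_1_simple`: `c_k = O(k^{−3/4})` implies
that every zero of `riemannZeta` is simple. [cite: BaezDuarte2005, Thm. 1.1 (simplicity clause), §3 pp. 3533–3534] -/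
theorem BaezDuarte2005_thm_1_1_simple_holds : BaezDuarte2005_thm_1_1_simple :=
  fun hO _s hs ↦ baezDuarte_simple_zeros_of_isBigO hO hs

end Literature.NumberTheory.LFunctions

end
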